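import Summits.CriticalPhenomena.PercolationContinuityZ3.Theorems.Transplant.HcpScope
import Summits.CriticalPhenomena.PercolationContinuityZ3.Theorems.Transplant.PlanarSkeletonFrmDefs
import Summits.CriticalPhenomena.PercolationContinuityZ3.Theorems.Transplant.PlanarSkeletonSignDefs
import HarnessLib

/-!
# hcp carries a TWO-type UNIT-step frames-only planar skeleton (`Hcp.skeletonFrm₂ : PlanarSkeletonFrm hcpGraph`, chart `(a + b, z)`) and the axis
# flip `flipSnd` at EVERY vertex (the basal mirror) — kernel placement certificate: hcp lies in cell (M) of the wall at scale `N = 1` (no node)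

builds on p205010 (kernel theorem, internal audit signed; external expert review pending) — nothing in this file uses p205010; NOTHING is claimed about
`θ_{hcp}(p_c)` nor about any node.  Lane `prim-bschramm`, seat `prim-bschramm-p4` (gen 20; PART C3, `HOME/bschramm/P4-GENERAL.md` §42.4).  Helper file
(`--supports stmt-CriticalPhenomena-4575 --as helper`).

STATE OF THE hcp ROW BEFORE THIS FILE: no `PlanarSkeletonConc` (`Hcp.isEmpty_planarSkeletonConc_hcp`, p2); `θ(p_c) = 0` modulo the ONE-type SCALED node
`U_s` (`Hcp.criticalContinuity_of_frmScaledNode₁`, g18, via the c-glide and the functional `a − b`, which is NOT 1-Lipschitz on p2's bond table: `|Δ| = 2`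
on the bond `(−1,1,0)`).  THIS FILE: on p2's integer model `Hcp.hcpGraph` the chart **`chart (a,b,z) := (a + b, z)`** is sup-norm 1-Lipschitz on all 24 bond
vectors (`bonds_chart_le`), the four outward UNIT steps are single bonds everywhere (`(±1,0,0) ↦ ±e₀`, `(0,0,±1) ↦ ±e₁`), the even translations
`Hcp.shift` are chart-translating frames with TWO base vertices `0` (A layers) and `(0,0,1)` (B layers), the cylinders are connected (fibres = the lines
`t + ℤ(1,−1,0)`, bonds themselves), so **`Hcp.skeletonFrm₂ : PlanarSkeletonFrm hcpGraph` with `skeletonFrm₂_types_card = 2`**; and the basal mirror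
`(a,b,z) ↦ (a,b,2c − z)` is an automorphism acting by `flipSnd` on the relative chart at every vertex of height `c` (`Hcp.exists_flipSnd`).  What hcp
does NOT have (R-level, P4 §42.4, not typed): an automorphism fixing a vertex and REVERSING `a + b` (the in-plane site group `D₃` sends `a+b` to `a+b`,
`−a`, `−b`; the layer exchange `Hcp.swap` reverses it but moves the vertex) — so hcp is neither a `PlanarSkeletonNeg`/`Sign` nor a `TwistedNeg` carrier for
this chart; it is a two-type UNIT frames-only carrier with flips: cell (M) of the wall at `N = 1` (it would fall to a multi-type unit frames-only node,
(A4)'s question), in addition to "modulo `U_s`".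
* §1 `chart`, `bonds_chart_le`, `lip`, `chart_shift`; §2 steps; §3 cylinders (`exists_reachable_fibre`, `fibre_reachable`, `cyl_connected`);
  §4 **`skeletonFrm₂`**, `skeletonFrm₂_types_card`; §5 `zflip`, **`exists_flipSnd`**.
[cite: ConwaySloane1999, Ch. 4 §6.1 (the hexagonal close packing)] [cite: KozmaNitzan2024, §4 p. 15 (outward steps, boxes), p. 16 (Lemma 8)]
-/

noncomputable section

namespace Summit.CriticalPhenomena.PercolationContinuityZ3.Theorems.Transplant

namespace Hcp

open SimpleGraph Literature.Probability.LatticeModels Literature.Probability.Percolation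
open scoped Classical

/-! ## §1 The chart `(a + b, z)`: Lipschitz, frames -/

/-- The planar chart `(a, b, z) ↦ (a + b, z)`. [cite: KozmaNitzan2024, §4 p. 15 (the coordinate map)] -/
def chart (x : Site 3) : Site 2 := ![x 0 + x 1, x 2]

/-- `chart` is additive. [folklore] -/
theorem chart_add (x y : Site 3) : chart (x + y) = chart x + chart y := by
  funext j
  fin_cases j <;> simp [chart]
  ring

/-- `chart` is subtractive. [folklore] -/
theorem chart_sub (x y : Site 3) : chart (x - y) = chart x - chart y := by
  funext j
  fin_cases j <;> simp [chart]
  ring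

/-- Every bond vector has chart of sup-norm `≤ 1`. [folklore] -/
theorem bonds_chart_le : ∀ e : Bool, ∀ v ∈ bonds e, |v 0 + v 1| ≤ 1 ∧ |v 2| ≤ 1 := by decide

/-- **The chart is 1-Lipschitz in the sup-norm along bonds.** [cite: KozmaNitzan2024, §4 p. 15] -/
theorem lip {x y : Site 3} (h : hcpGraph.Adj x y) (j : Fin 2) : |chart x j - chart y j| ≤ 1 := by
  have hb := bonds_chart_le _ _ ((hcp_adj_iff x y).1 h)
  rw [abs_sub_comm, ← Pi.sub_apply, ← chart_sub]
  fin_cases j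
  · simpa [chart] using hb.1
  · simpa [chart] using hb.2

/-- Frames translate the chart: `chart (g + x) = chart x + chart g`. [folklore] -/
theorem chart_shift (g : Site 3) (hg : g 2 % 2 = 0) (x : Site 3) : chart (shift g hg x) = chart x + chart g := by
  rw [shift_apply, chart_add, add_comm]

/-! ## §2 The four outward unit steps are single bonds at every vertex -/

/-- **(ι)**: `(±1,0,0) ↦ ±e₀` and `(0,0,±1) ↦ ±e₁` are bonds from every site. [cite: KozmaNitzan2024, §4 p. 15 (outward steps)] -/
theorem step (x : Site 3) (i : Fin 2) (σ : ℤˣ) : ∃ y : Site 3, hcpGraph.Adj x y ∧ chart y = chart x + Pi.single i (σ : ℤ) := by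
  obtain ⟨hu, hd, hp0, hm0, -, -⟩ := basic_bonds (evenLayer x)
  fin_cases i <;> rcases Int.units_eq_one_or σ with rfl | rfl
  · exact ⟨x + ![1, 0, 0], (hcp_adj_add_iff _ _).2 hp0, by rw [chart_add]; funext j; fin_cases j <;> simp [chart]⟩
  · exact ⟨x + ![-1, 0, 0], (hcp_adj_add_iff _ _).2 hm0, by rw [chart_add]; funext j; fin_cases j <;> simp [chart]⟩
  · exact ⟨x + ![0, 0, 1], (hcp_adj_add_iff _ _).2 hu, by rw [chart_add]; funext j; fin_cases j <;> simp [chart]⟩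
  · exact ⟨x + ![0, 0, -1], (hcp_adj_add_iff _ _).2 hd, by rw [chart_add]; funext j; fin_cases j <;> simp [chart]⟩

/-! ## §3 (κ): connected cylinders -/

/-- **Descent**: inside a cylinder every vertex is joined, INSIDE the cylinder, to a vertex over the base chart value. [folklore] -/
theorem exists_reachable_fibre (t : Site 3) (ℓ : ℕ) (w : Site 3) (hw : w ∈ {x | chart x - chart t ∈ box 2 ℓ}) :
    ∃ (w₀ : Site 3) (h₀ : w₀ ∈ {x | chart x - chart t ∈ box 2 ℓ}), chart w₀ = chart t ∧
      (hcpGraph.induce {x | chart x - chart t ∈ box 2 ℓ}).Reachable ⟨w, hw⟩ ⟨w₀, h₀⟩ := by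
  suffices H : ∀ n : ℕ, ∀ (w : Site 3) (hw : w ∈ {x | chart x - chart t ∈ box 2 ℓ}),
      ((chart w - chart t) 0).natAbs + ((chart w - chart t) 1).natAbs = n →
      ∃ (w₀ : Site 3) (h₀ : w₀ ∈ {x | chart x - chart t ∈ box 2 ℓ}), chart w₀ = chart t ∧
        (hcpGraph.induce {x | chart x - chart t ∈ box 2 ℓ}).Reachable ⟨w, hw⟩ ⟨w₀, h₀⟩ from H _ w hw rfl
  intro n
  induction n using Nat.strong_induction_on with
  | _ n ih =>
    intro w hw hn
    set d : Site 2 := chart w - chart t with hd_def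
    have hbox : ∀ j, -(ℓ : ℤ) ≤ d j ∧ d j ≤ ℓ := mem_box.1 hw
    by_cases h0 : d 0 = 0 ∧ d 1 = 0
    · refine ⟨w, hw, ?_, Reachable.refl _⟩
      have hd0 : d = 0 := by funext j; fin_cases j; exacts [h0.1, h0.2]
      exact sub_eq_zero.1 (hd_def ▸ hd0)
    obtain ⟨i, hi⟩ : ∃ i : Fin 2, d i ≠ 0 := by
      by_contra hc
      exact h0 ⟨not_not.1 fun h => hc ⟨0, h⟩, not_not.1 fun h => hc ⟨1, h⟩⟩
    obtain ⟨s, hs1, hlt, hrange⟩ : ∃ s : ℤ, (s = 1 ∨ s = -1) ∧ (d i + s).natAbs < (d i).natAbs ∧ (-(ℓ : ℤ) ≤ d i + s ∧ d i + s ≤ ℓ) := by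
      have hb := hbox i
      rcases lt_or_gt_of_ne hi with hlt | hgt
      · exact ⟨1, Or.inl rfl, by omega, by omega⟩
      · exact ⟨-1, Or.inr rfl, by omega, by omega⟩
    obtain ⟨σ, hσ⟩ : ∃ σ : ℤˣ, (σ : ℤ) = s := by
      rcases hs1 with rfl | rfl
      exacts [⟨1, rfl⟩, ⟨-1, rfl⟩]
    obtain ⟨v', hadj, hφ⟩ := step w i σ
    have hdiff : chart v' - chart t = d + Pi.single i s := by rw [hφ, hσ, hd_def]; abel
    have hv' : v' ∈ {x | chart x - chart t ∈ box 2 ℓ} := by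
      show chart v' - chart t ∈ box 2 ℓ
      rw [mem_box]; intro j; rw [hdiff, Pi.add_apply]
      by_cases hj : j = i
      · subst hj; rw [Pi.single_eq_same]; exact hrange
      · rw [Pi.single_eq_of_ne hj, add_zero]; exact hbox j
    have hlt' : ((chart v' - chart t) 0).natAbs + ((chart v' - chart t) 1).natAbs < n := by
      rw [← hn, hdiff]
      fin_cases i <;> simp at hlt ⊢ <;> omega
    obtain ⟨w₀, h₀, hφ₀, hreach⟩ := ih _ hlt' v' hv' rfl
    exact ⟨w₀, h₀, hφ₀, (show (hcpGraph.induce _).Adj ⟨w, hw⟩ ⟨v', hv'⟩ from hadj).reachable.trans hreach⟩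

/-- A point of the fibre over `chart t` is `t + k (1,−1,0)`. [folklore] -/
theorem eq_add_diag_of_chart_eq {t w : Site 3} (h : chart w = chart t) : w = t + ![w 0 - t 0, -(w 0 - t 0), 0] := by
  have h1 : w 0 + w 1 = t 0 + t 1 := by simpa [chart] using congrFun h 0
  have h2 : w 2 = t 2 := by simpa [chart] using congrFun h 1
  funext k; fin_cases k
  · simp
  · simp; omega
  · simp [h2]

/-- The fibre direction `(1,−1,0)` does not move the chart. [folklore] -/
theorem chart_add_diag (t : Site 3) (k : ℤ) : chart (t + ![k, -k, 0]) = chart t := by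
  rw [chart_add]; funext j; fin_cases j <;> simp [chart]

/-- `(1,−1,0)` and `(−1,1,0)` are bonds from every site. [folklore] -/
theorem diag_mem_bonds : ∀ e : Bool, (![1, -1, 0] : Site 3) ∈ bonds e ∧ (![-1, 1, 0] : Site 3) ∈ bonds e := by decide

/-- **The fibre is a chain of bonds**: every `t + k(1,−1,0)` is joined to `t` inside every cylinder at `t`. [cite: KozmaNitzan2024, §4 p. 15] -/
theorem fibre_reachable (t : Site 3) (ℓ : ℕ) (h1 : t ∈ {x | chart x - chart t ∈ box 2 ℓ}) :
    ∀ (n : ℕ) (w : {x | chart x - chart t ∈ box 2 ℓ}) (k : ℤ), (w : Site 3) = t + ![k, -k, 0] → k.natAbs = n →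
      (hcpGraph.induce {x | chart x - chart t ∈ box 2 ℓ}).Reachable ⟨t, h1⟩ w := by
  intro n
  induction n using Nat.strong_induction_on with
  | _ n ih =>
    rintro ⟨wv, hw⟩ k hwk hkn
    simp only at hwk
    subst hwk
    by_cases hk0 : k = 0
    · subst hk0
      have e : t + (![(0 : ℤ), -0, 0] : Site 3) = t := by
        have : (![(0 : ℤ), -0, 0] : Site 3) = 0 := by funext j; fin_cases j <;> simp
        rw [this, add_zero]
      have ept : (⟨t + ![(0 : ℤ), -0, 0], hw⟩ : {x | chart x - chart t ∈ box 2 ℓ}) = ⟨t, h1⟩ := Subtype.ext e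
      rw [ept]
    obtain ⟨s, hs, hlt⟩ : ∃ s : ℤ, (s = 1 ∨ s = -1) ∧ (k - s).natAbs < k.natAbs := by
      rcases lt_or_gt_of_ne hk0 with h | h
      · exact ⟨-1, Or.inr rfl, by omega⟩
      · exact ⟨1, Or.inl rfl, by omega⟩
    have hmem : t + ![k - s, -(k - s), 0] ∈ {x | chart x - chart t ∈ box 2 ℓ} := by
      show chart (t + ![k - s, -(k - s), 0]) - chart t ∈ box 2 ℓ
      rw [chart_add_diag, sub_self]; exact zero_mem_box 2 ℓ
    have hadj : hcpGraph.Adj (t + ![k, -k, 0]) (t + ![k - s, -(k - s), 0]) := by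
      have e : t + ![k - s, -(k - s), 0] = t + ![k, -k, 0] + ![-s, s, 0] := by
        rw [add_assoc]; congr 1; funext j; fin_cases j <;> simp <;> ring
      rw [e, hcp_adj_add_iff]
      rcases hs with rfl | rfl
      · simpa using (diag_mem_bonds (evenLayer (t + ![k, -k, 0]))).2
      · simpa using (diag_mem_bonds (evenLayer (t + ![k, -k, 0]))).1
    have hlt_n : (k - s).natAbs < n := by rw [← hkn]; exact hlt
    have r := ih _ hlt_n ⟨_, hmem⟩ (k - s) rfl rfl
    exact r.trans (show (hcpGraph.induce _).Adj ⟨_, hmem⟩ ⟨_, hw⟩ from hadj.symm).reachable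

/-- **(κ) for the chart `(a+b, z)`: every cylinder at every vertex, every half-width, induces a connected subgraph.** [cite: KozmaNitzan2024, §4 p. 15] -/
theorem cyl_connected (t : Site 3) (ℓ : ℕ) : (hcpGraph.induce {x | chart x - chart t ∈ box 2 ℓ}).Connected := by
  have h1 : t ∈ {x | chart x - chart t ∈ box 2 ℓ} := by
    show chart t - chart t ∈ box 2 ℓ; rw [sub_self]; exact zero_mem_box 2 ℓ
  haveI : Nonempty {x | chart x - chart t ∈ box 2 ℓ} := ⟨⟨t, h1⟩⟩
  have key : ∀ w : {x | chart x - chart t ∈ box 2 ℓ}, (hcpGraph.induce {x | chart x - chart t ∈ box 2 ℓ}).Reachable ⟨t, h1⟩ w := by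
    rintro ⟨w, hw⟩
    obtain ⟨w₀, h₀, hφ, hr⟩ := exists_reachable_fibre t ℓ w hw
    have e := eq_add_diag_of_chart_eq hφ
    have r0 := fibre_reachable t ℓ h1 _ ⟨w₀, h₀⟩ (w₀ 0 - t 0) e rfl
    exact r0.trans hr.symm
  exact ⟨fun u v => (key u).symm.trans (key v)⟩

/-! ## §4 The two-type frames-only skeleton -/

/-- The base vertex of the B layers. [folklore] -/
def b₁ : Site 3 := ![0, 0, 1]

/-- **`hcp` CARRIES A TWO-TYPE UNIT-STEP `PlanarSkeletonFrm`** (chart `(a+b, z)`, frames = even translations, base vertices `0` and `(0,0,1)`).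
[cite: KozmaNitzan2024, §4 p. 16 (Lemma 8)] [cite: ConwaySloane1999, Ch. 4 §6.1] -/
def skeletonFrm₂ : PlanarSkeletonFrm hcpGraph where
  φ := chart
  lip := fun _ _ h j => lip h j
  types := {0, b₁}
  frame := fun v => by
    rcases Int.emod_two_eq_zero_or_one (v 2) with hv | hv
    · refine ⟨0, by simp, shift v hv, by rw [shift_apply, add_zero], fun w => ?_⟩
      rw [chart_shift]
      simp [chart]
    · have hg : (v - b₁) 2 % 2 = 0 := by
        show (v 2 - (![(0 : ℤ), 0, 1] : Site 3) 2) % 2 = 0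
        simp only [Matrix.cons_val_two, Matrix.tail_cons, Matrix.head_cons]; omega
      refine ⟨b₁, by simp, shift (v - b₁) hg, by rw [shift_apply, sub_add_cancel], fun w => ?_⟩
      rw [chart_shift, chart_sub]
  Δ := 12
  degree_le := fun v => (hcp_degree v).le
  step := step
  cyl_connected := fun t _ ℓ _ => cyl_connected t ℓ

/-- Exactly two base vertices. [folklore] -/
theorem skeletonFrm₂_types_card : skeletonFrm₂.types.card = 2 := by
  show ({0, b₁} : Finset (Site 3)).card = 2
  rw [Finset.card_pair]
  intro h
  have := congrFun h 2
  simp [b₁] at this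

/-! ## §5 The basal mirror: `flipSnd` at every vertex -/

/-- The basal mirror through height `c`: `(a, b, z) ↦ (a, b, 2c − z)`. [folklore] -/
def zflipFun (c : ℤ) (x : Site 3) : Site 3 := ![x 0, x 1, 2 * c - x 2]

/-- The basal mirror is an involution. [folklore] -/
theorem zflipFun_zflipFun (c : ℤ) (x : Site 3) : zflipFun c (zflipFun c x) = x := by
  funext j; fin_cases j <;> simp [zflipFun]

/-- The basal mirror preserves the layer parity. [folklore] -/
theorem evenLayer_zflipFun (c : ℤ) (x : Site 3) : evenLayer (zflipFun c x) = evenLayer x := by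
  unfold evenLayer zflipFun
  simp only [Matrix.cons_val_two, Matrix.tail_cons, Matrix.head_cons]
  rcases Int.emod_two_eq_zero_or_one (x 2) with h | h
  · rw [h, show (2 * c - x 2) % 2 = 0 by omega]
  · rw [h, show (2 * c - x 2) % 2 = 1 by omega]

/-- Differences under the basal mirror: `(Δa, Δb, −Δz)`. [folklore] -/
theorem zflipFun_sub (c : ℤ) (x y : Site 3) : zflipFun c y - zflipFun c x = ![(y - x) 0, (y - x) 1, -((y - x) 2)] := by
  funext j; fin_cases j <;> simp [zflipFun]

/-- The bond tables are invariant under `(Δa, Δb, Δz) ↦ (Δa, Δb, −Δz)`. [folklore] -/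
theorem zneg_mem_bonds : ∀ e : Bool, ∀ v ∈ bonds e, (![v 0, v 1, -v 2] : Site 3) ∈ bonds e := by decide

/-- **The basal mirror through height `c` is an automorphism of hcp.** [cite: KozmaNitzan2024, §4 p. 16 (Lemma 8: the lattice symmetries)] -/
def zflip (c : ℤ) : hcpGraph ≃g hcpGraph where
  toEquiv := ⟨zflipFun c, zflipFun c, zflipFun_zflipFun c, zflipFun_zflipFun c⟩
  map_rel_iff' := by
    intro x y
    show hcpGraph.Adj (zflipFun c x) (zflipFun c y) ↔ hcpGraph.Adj x y
    rw [hcp_adj_iff, hcp_adj_iff, zflipFun_sub, evenLayer_zflipFun]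
    constructor
    · intro h
      have h' := zneg_mem_bonds _ _ h
      have e : (![(![(y - x) 0, (y - x) 1, -(y - x) 2] : Site 3) 0, (![(y - x) 0, (y - x) 1, -(y - x) 2] : Site 3) 1,
          -(![(y - x) 0, (y - x) 1, -(y - x) 2] : Site 3) 2] : Site 3) = y - x := by
        funext j; fin_cases j <;> simp
      rwa [e] at h'
    · intro h
      exact zneg_mem_bonds _ _ h

/-- **`flipSnd` at every vertex**: the basal mirror through the height of `t` fixes `t` and reverses the second relative chart coordinate.
[cite: KozmaNitzan2024, §4 p. 16 (Lemma 8)] -/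
theorem exists_flipSnd (t : Site 3) : ∃ α : hcpGraph ≃g hcpGraph, α t = t ∧ ∀ w, chart (α w) - chart t = flipSnd (chart w - chart t) := by
  refine ⟨zflip (t 2), ?_, fun w => ?_⟩
  · show zflipFun (t 2) t = t
    funext j; fin_cases j <;> simp [zflipFun]; ring
  · show chart (zflipFun (t 2) w) - chart t = flipSnd (chart w - chart t)
    funext j
    fin_cases j <;> simp [chart, zflipFun, flipSnd]
    ring

end Hcp

end Summit.CriticalPhenomena.PercolationContinuityZ3.Theorems.Transplant

end
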